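import Literature.NumberTheory.Automorphic.CompactCoreLevelPoint
import Literature.NumberTheory.Rogawski1990.AdelicStableConjugacyG
import HarnessLib

/-!
# Mass one at CONJUGATE points: the compact core of `Z(aγa⁻¹)` lies in `K` when that of `Z(γ)` does and `a ∈ K`, and the
# a.e. normalisation `∃ S₀, IsNormalisedOff` at every ADELIC conjugate of a normalised point
(Rogawski (1990), §4.3 pp. 43–44: «measures normalised so that `K ∩ T` has measure one for almost all `v`»; Kottwitz (1986) §7)

Topic `NumberTheory/Automorphic`; namespace `Literature.NumberTheory.Automorphic` (sequel of ★ F4-a `CompactCoreLevel` and of F0P3a-p05's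
★ `CompactCoreLevelPoint`).  THEOREMS ONLY: no definition, no named fact, no instance, no `sorry`.  Cell `pub/hodgecm-mathlib`, ENGINE T1, ED 1.19c:
the adelic-class-indexed family ★-to-be Q4-C3 `OrbitalMeasureFamily.ofLocalAdelic m_f m_∞ c` is the honest (non-junk) measure only under
`∃ S₀, UnitaryGroup.IsNormalisedOff … (Quotient.out c) S₀` at the (arbitrary adelic) REPRESENTATIVE `out c`; for a rational class this representative is
an adelic CONJUGATE `a γ a⁻¹` (`a ∈ U(H)(𝔸)`) of the rational point, and `a_v ∈ K_v` for almost all `v` — so the compact cores of the local centralisers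
conjugate INSIDE `K_v` almost everywhere and ★ `OrbitalMeasureFamily.IsCanonical.atPoint_image_mk_eq_one` applies at the conjugate point.

* §1 (generic topological group) `compactCore_centralizer_conj_subset` — `compactCore Z(γ) ⊆ K`, `a ∈ K` ⇒ `compactCore Z(aγa⁻¹) ⊆ K`
  (★ `image_compactCore` along the restriction `Z(γ) ≃ₜ* Z(aγa⁻¹)` of `conj a`, built inline); `compactCore_centralizer_conj_subset_of_mem_mul` —
  the same for `a ∈ K · Z(γ)`.
* §2 (`U(H)`, any `N`, any `H`; local families `mG v` CANONICAL for `(P_v, ν_v)` with `ν_v(K_v) = 1`) `UnitaryGroup.exists_isNormalisedOff_of_eventually`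
  — `∃ S₀, IsNormalisedOff L N H mG y S₀` for EVERY adelic `y` whose local centralisers have compact core in `K_v` a.e. (the hypothesis ★
  `CompactCoreCentralizerLevelAE` supplies at rational points); `UnitaryGroup.exists_isNormalisedOff_conj` — hence at every adelic conjugate
  `a y a⁻¹`; `UnitaryGroup.exists_isNormalisedOff_of_isConj_toAdelic` — hence at every adelic conjugate of a regular RATIONAL `γ` under ★
  `CompactCoreCentralizerLevelAE` (discharges the second normalisation hypothesis `hS₀′` of Q4-C3's bridge to ★ Q4-C2 `ofLocal`).
* §3 (`G = U(Φ₃)`) **`UnitaryGroup.exists_isNormalisedOff_matchingAdeleG`** — under ★ `MatchingAdeleGEventuallyKConj` (T1b-9G ed. 2, print's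
  `K_v`-form of [Kt₄] Prop. 7.1) and ★ `CompactCoreCentralizerLevelAE L 3 Φ₃`, a canonical family on `U(Φ₃)` with `ν_v(K_v) = 1` is normalised off a
  finite set at EVERY matching adèle `p ∈ 𝒪_st(γ₀ ∕ 𝐀)` over a regular rational `γ₀ ∈ U(H)(L⁺)` — the normalisability of the ED 1.19c (xii″)
  measure data `ofLocalAdelic mq mqi` at every class of the adelic stable class (`mq` canonical by ★ `transport_isCanonical_isRegularElt`).
HC_CM is proved only modulo the printed citations until rung 0 closes; this file is unconditional.

## References
* [Rogawski1990] J. D. Rogawski, *Automorphic Representations of Unitary Groups in Three Variables*, Ann. of Math. Stud. 123 (1990), §4.3 pp. 43–44.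
* [Kottwitz1986] R. Kottwitz, *Stable trace formula: elliptic singular terms*, Math. Ann. 275 (1986), §7.
-/

noncomputable section

open MeasureTheory Measure Set NumberField IsDedekindDomain Filter
open Literature.MeasureTheory.Group
open scoped ENNReal NNReal Pointwise

namespace Literature.NumberTheory.Automorphic

/-! ## §1 Compact cores of centralisers conjugate inside `K` -/

section Conj

variable {G : Type*} [Group G] [TopologicalSpace G] [IsTopologicalGroup G]

/-- **`compactCore Z(aγa⁻¹) ⊆ K` when `compactCore Z(γ) ⊆ K` and `a ∈ K`**: the inner automorphism `conj a` restricts to an isomorphism of topological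
groups `Z(γ) ≃ₜ* Z(aγa⁻¹)`, the compact core is intrinsic (★ `image_compactCore`), and `a K a⁻¹ = K`. [cite: Rogawski1990, §4.3 (p. 43)] -/
theorem compactCore_centralizer_conj_subset (K : Subgroup G) (γ a : G) (ha : a ∈ K)
    (h : compactCore (Subgroup.centralizer ({γ} : Set G)) ⊆ Subtype.val ⁻¹' (K : Set G)) :
    compactCore (Subgroup.centralizer ({a * γ * a⁻¹} : Set G)) ⊆ Subtype.val ⁻¹' (K : Set G) := by
  -- the restriction of `conj a` to the centralisers
  have hφγ : (MulAut.conj a : G ≃* G) γ = a * γ * a⁻¹ := rfl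
  have hZZ' := forall_apply_mem_centralizer_singleton_iff_of_eq (MulAut.conj a : G ≃* G) hφγ
  let eH : Subgroup.centralizer ({γ} : Set G) ≃ₜ Subgroup.centralizer ({a * γ * a⁻¹} : Set G) :=
    subgroupCongrHomeomorph (MulAut.conj a : G ≃* G) _ _ hZZ' (continuous_mulAutConj a) (continuous_mulAutConj_symm a)
  let eZ : Subgroup.centralizer ({γ} : Set G) ≃ₜ* Subgroup.centralizer ({a * γ * a⁻¹} : Set G) :=
    { toMulEquiv :=
        { toEquiv := eH.toEquiv
          map_mul' := fun x y => Subtype.ext (map_mul (MulAut.conj a : G ≃* G) (x : G) (y : G)) }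
      continuous_toFun := eH.continuous
      continuous_invFun := eH.symm.continuous }
  rw [← image_compactCore eZ]
  rintro _ ⟨z, hz, rfl⟩
  -- `val (eZ z) = a * z * a⁻¹ ∈ K`
  change a * (z : G) * a⁻¹ ∈ (K : Set G)
  exact K.mul_mem (K.mul_mem ha (h hz)) (K.inv_mem ha)

/-- The same for a conjugator `a ∈ K · Z(γ)` (`a = k z`, `aγa⁻¹ = kγk⁻¹`). [cite: Rogawski1990, §4.3 (p. 43)] [cite: Kottwitz1986, §7] -/
theorem compactCore_centralizer_conj_subset_of_mem_mul (K : Subgroup G) (γ a : G)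
    (ha : a ∈ (K : Set G) * (Subgroup.centralizer ({γ} : Set G) : Set G))
    (h : compactCore (Subgroup.centralizer ({γ} : Set G)) ⊆ Subtype.val ⁻¹' (K : Set G)) :
    compactCore (Subgroup.centralizer ({a * γ * a⁻¹} : Set G)) ⊆ Subtype.val ⁻¹' (K : Set G) := by
  obtain ⟨k, hk, z, hz, rfl⟩ := ha
  have hzγ : z * γ * z⁻¹ = γ := by
    rw [Subgroup.mem_centralizer_singleton_iff.1 (SetLike.mem_coe.1 hz), mul_inv_cancel_right]
  have heq : k * z * γ * (k * z)⁻¹ = k * γ * k⁻¹ := by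
    rw [mul_inv_rev, show k * z * γ * (z⁻¹ * k⁻¹) = k * (z * γ * z⁻¹) * k⁻¹ by group, hzγ]
  rw [heq]
  exact compactCore_centralizer_conj_subset K γ k hk h

end Conj

/-! ## §2 `∃ S₀, IsNormalisedOff` at adelic points with a.e.-small compact cores, at adelic conjugates, and at adelic conjugates of rational points -/

namespace UnitaryGroup

variable (L : Type) [Field L] [NumberField L] [IsCMField L] (N : ℕ) (H : Matrix (Fin N) (Fin N) L)
  [∀ (v : HeightOneSpectrum (𝓞 ↥(maximalRealSubfield L))) (x : (cmDatum L N H).Local v),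
    MeasurableSpace ((cmDatum L N H).Local v ⧸ Subgroup.centralizer ({x} : Set ((cmDatum L N H).Local v)))]
  [∀ (v : HeightOneSpectrum (𝓞 ↥(maximalRealSubfield L))) (x : (cmDatum L N H).Local v),
    BorelSpace ((cmDatum L N H).Local v ⧸ Subgroup.centralizer ({x} : Set ((cmDatum L N H).Local v)))]
  [∀ v : HeightOneSpectrum (𝓞 ↥(maximalRealSubfield L)), MeasurableSpace ((cmDatum L N H).Local v)]
  [∀ v : HeightOneSpectrum (𝓞 ↥(maximalRealSubfield L)), BorelSpace ((cmDatum L N H).Local v)]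
  [∀ v : HeightOneSpectrum (𝓞 ↥(maximalRealSubfield L)), SecondCountableTopology ((cmDatum L N H).Local v)]
  (P : ∀ v : HeightOneSpectrum (𝓞 ↥(maximalRealSubfield L)), (cmDatum L N H).Local v → Prop)
  (νG : ∀ v : HeightOneSpectrum (𝓞 ↥(maximalRealSubfield L)), Measure ((cmDatum L N H).Local v))
  [∀ v, (νG v).IsHaarMeasure] [∀ v, (νG v).IsMulRightInvariant]
  (mG : ∀ v : HeightOneSpectrum (𝓞 ↥(maximalRealSubfield L)), OrbitalMeasureFamily ((cmDatum L N H).Local v))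

/-- **Normalised off a finite set at ANY adelic point with a.e.-small compact cores**: local families `mG v` canonical for `(P_v, ν_v)`, `ν_v(K_v) = 1`;
an adelic `y` with `P_v (out ⟦y_v⟧)` at every `v` and `compactCore Z(y_v) ⊆ K_v` for almost all `v` is normalised off a finite set: `∃ S₀,
IsNormalisedOff L N H mG y S₀` (★ `IsCanonical.atPoint_image_mk_eq_one` place by place). The point `y` need NOT be rational.
[cite: Rogawski1990, §4.3 (p. 43)] -/
theorem exists_isNormalisedOff_of_eventually (hν : ∀ v, νG v (cmLocalIntegralLevel L N H v) = 1)
    (hcan : ∀ v, (mG v).IsCanonical (P v) (νG v)) (y : (cmDatum L N H).Adelic)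
    (hP : ∀ v, P v (Quotient.out (ConjClasses.mk ((cmDatum L N H).toLocal v y))))
    (hcc : ∀ᶠ v in cofinite, compactCore (Subgroup.centralizer ({(cmDatum L N H).toLocal v y} : Set ((cmDatum L N H).Local v))) ⊆
      Subtype.val ⁻¹' (cmLocalIntegralLevel L N H v : Set ((cmDatum L N H).Local v))) :
    ∃ S₀ : Finset (HeightOneSpectrum (𝓞 ↥(maximalRealSubfield L))), IsNormalisedOff L N H mG y S₀ := by
  rw [Filter.eventually_cofinite] at hcc
  refine ⟨hcc.toFinset, fun v hv => ?_⟩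
  have hv' : compactCore (Subgroup.centralizer ({(cmDatum L N H).toLocal v y} : Set ((cmDatum L N H).Local v))) ⊆
      Subtype.val ⁻¹' (cmLocalIntegralLevel L N H v : Set ((cmDatum L N H).Local v)) := by
    by_contra hnot
    exact hv (hcc.mem_toFinset.2 hnot)
  obtain ⟨hKc, hKo⟩ := isCompact_isOpen_cmLocalIntegralLevel L N H v
  exact (hcan v).atPoint_image_mk_eq_one _ (hP v) (cmLocalIntegralLevel L N H v) hKo hKc (hν v) hv'

/-- **Normalised at every adelic CONJUGATE**: if the compact cores at `y` are a.e. in `K_v`, then so are those at `a y a⁻¹` for EVERY adelic `a`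
(`a_v ∈ K_v` for almost all `v`, ★ `eventually_toLocal_mem_cmLocalIntegralLevel`; §1), hence `∃ S₀, IsNormalisedOff L N H mG (a * y * a⁻¹) S₀`.
[cite: Rogawski1990, §4.3 (p. 43)] -/
theorem exists_isNormalisedOff_conj (hν : ∀ v, νG v (cmLocalIntegralLevel L N H v) = 1)
    (hcan : ∀ v, (mG v).IsCanonical (P v) (νG v)) (y a : (cmDatum L N H).Adelic)
    (hP : ∀ v, P v (Quotient.out (ConjClasses.mk ((cmDatum L N H).toLocal v (a * y * a⁻¹)))))
    (hcc : ∀ᶠ v in cofinite, compactCore (Subgroup.centralizer ({(cmDatum L N H).toLocal v y} : Set ((cmDatum L N H).Local v))) ⊆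
      Subtype.val ⁻¹' (cmLocalIntegralLevel L N H v : Set ((cmDatum L N H).Local v))) :
    ∃ S₀ : Finset (HeightOneSpectrum (𝓞 ↥(maximalRealSubfield L))), IsNormalisedOff L N H mG (a * y * a⁻¹) S₀ := by
  refine exists_isNormalisedOff_of_eventually L N H P νG mG hν hcan (a * y * a⁻¹) hP ?_
  filter_upwards [hcc, Rogawski1990.eventually_toLocal_mem_cmLocalIntegralLevel a] with v hv ha
  rw [map_mul, map_mul, map_inv]
  exact compactCore_centralizer_conj_subset (cmLocalIntegralLevel L N H v) _ _ ha hv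

/-- **Normalised at every adelic conjugate of a regular RATIONAL point**, under the named fact ★ `CompactCoreCentralizerLevelAE L N H` (F4-a): for
`γ ∈ U(H)(L⁺)` regular and any adelic `y` conjugate to `toAdelic γ` in `U(H)(𝔸)` (e.g. `y = out ⟦toAdelic γ⟧`, the representative Q4-C3 reads),
`∃ S₀, IsNormalisedOff L N H mG y S₀` — the second normalisation hypothesis of the Q4-C3 ↔ Q4-C2 bridge is a CONSEQUENCE of the first's source.
[cite: Rogawski1990, §4.3 (p. 43)] -/
theorem exists_isNormalisedOff_of_isConj_toAdelic (hν : ∀ v, νG v (cmLocalIntegralLevel L N H v) = 1)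
    (hcan : ∀ v, (mG v).IsCanonical (P v) (νG v)) (hF : CompactCoreCentralizerLevelAE L N H)
    (γ : (cmDatum L N H).Rational) (hγ : Rogawski1990.IsRegularElt (γ.val : GL (Fin N) L)) (y : (cmDatum L N H).Adelic)
    (hy : IsConj ((cmDatum L N H).toAdelic γ) y) (hP : ∀ v, P v (Quotient.out (ConjClasses.mk ((cmDatum L N H).toLocal v y)))) :
    ∃ S₀ : Finset (HeightOneSpectrum (𝓞 ↥(maximalRealSubfield L))), IsNormalisedOff L N H mG y S₀ := by
  obtain ⟨a, ha⟩ := isConj_iff.1 hy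
  subst ha
  exact exists_isNormalisedOff_conj L N H P νG mG hν hcan _ a hP (hF γ hγ)


/-! ## §3 (G = U(Φ₃)) `∃ S₀, IsNormalisedOff` at every MATCHING ADÈLE over a regular rational `γ₀ ∈ U(H)(L⁺)` -/

/-- **Normalised at every matching adèle of the quasi-split group.**  `m v` canonical local families on `U(Φ₃)(L⁺_v)` for `(P_v, ν_v)` with
`ν_v(U(Φ₃)(𝒪_v)) = 1`; named facts ★ `MatchingAdeleGEventuallyKConj L H` (T1b-9G ed. 2: [Kt₄] Prop. 7.1 in print's `K_v`-form) and ★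
`CompactCoreCentralizerLevelAE L 3 Φ₃` (F4-a); `γ₀ ∈ U(H)(L⁺)` regular with a rational correspondent `γ ∈ U(Φ₃)(L⁺)` (one exists, ★
`exists_corresponds_antidiagThree_all`).  Then EVERY `p ∈ 𝒪_st(γ₀ ∕ 𝐀) ⊂ U(Φ₃)(𝐀)` (★ `MatchingAdeleG`) with `P_v` at its local class representatives is
normalised off a finite set: for almost all `v`, `p_v ∈ K_v` (adelic), so `p_v = k γ_v k⁻¹` with `k ∈ K_v` (the fact), so `compactCore Z(p_v) =
conj_k '' compactCore Z(γ_v) ⊆ K_v` (§1 + the fact at `γ`), so the `π(K_v)`-mass of `(m v).atPoint p_v` is `1` (§2).  With `m := ComparisonKit.mq`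
(canonical by ★ `transport_isCanonical_isRegularElt`) this is the normalisability of the (xii″) measure data ★ `ofLocalAdelic mq mqi` at EVERY class of
the adelic stable class. [cite: Rogawski1990, §3.3 p. 21; §4.3 (pp. 43–44)] [cite: Kottwitz1986, Prop. 7.1] -/
theorem exists_isNormalisedOff_matchingAdeleG (H' : Matrix (Fin 3) (Fin 3) L)
    [∀ (v : HeightOneSpectrum (𝓞 ↥(maximalRealSubfield L)))
      (x : (cmDatum L 3 (Matrix.of fun i j : Fin 3 => if i.val + j.val + 1 = 3 then (1 : L) else 0)).Local v),
      MeasurableSpace ((cmDatum L 3 (Matrix.of fun i j : Fin 3 => if i.val + j.val + 1 = 3 then (1 : L) else 0)).Local v ⧸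
        Subgroup.centralizer ({x} : Set ((cmDatum L 3 (Matrix.of fun i j : Fin 3 => if i.val + j.val + 1 = 3 then (1 : L) else 0)).Local v)))]
    [∀ (v : HeightOneSpectrum (𝓞 ↥(maximalRealSubfield L)))
      (x : (cmDatum L 3 (Matrix.of fun i j : Fin 3 => if i.val + j.val + 1 = 3 then (1 : L) else 0)).Local v),
      BorelSpace ((cmDatum L 3 (Matrix.of fun i j : Fin 3 => if i.val + j.val + 1 = 3 then (1 : L) else 0)).Local v ⧸
        Subgroup.centralizer ({x} : Set ((cmDatum L 3 (Matrix.of fun i j : Fin 3 => if i.val + j.val + 1 = 3 then (1 : L) else 0)).Local v)))]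
    [∀ v : HeightOneSpectrum (𝓞 ↥(maximalRealSubfield L)),
      MeasurableSpace ((cmDatum L 3 (Matrix.of fun i j : Fin 3 => if i.val + j.val + 1 = 3 then (1 : L) else 0)).Local v)]
    [∀ v : HeightOneSpectrum (𝓞 ↥(maximalRealSubfield L)),
      BorelSpace ((cmDatum L 3 (Matrix.of fun i j : Fin 3 => if i.val + j.val + 1 = 3 then (1 : L) else 0)).Local v)]
    [∀ v : HeightOneSpectrum (𝓞 ↥(maximalRealSubfield L)),
      SecondCountableTopology ((cmDatum L 3 (Matrix.of fun i j : Fin 3 => if i.val + j.val + 1 = 3 then (1 : L) else 0)).Local v)]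
    (P : ∀ v : HeightOneSpectrum (𝓞 ↥(maximalRealSubfield L)),
      (cmDatum L 3 (Matrix.of fun i j : Fin 3 => if i.val + j.val + 1 = 3 then (1 : L) else 0)).Local v → Prop)
    (ν : ∀ v : HeightOneSpectrum (𝓞 ↥(maximalRealSubfield L)),
      Measure ((cmDatum L 3 (Matrix.of fun i j : Fin 3 => if i.val + j.val + 1 = 3 then (1 : L) else 0)).Local v))
    [∀ v, (ν v).IsHaarMeasure] [∀ v, (ν v).IsMulRightInvariant]
    (hν : ∀ v, ν v (cmLocalIntegralLevel L 3 (Matrix.of fun i j : Fin 3 => if i.val + j.val + 1 = 3 then (1 : L) else 0) v) = 1)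
    (m : ∀ v : HeightOneSpectrum (𝓞 ↥(maximalRealSubfield L)),
      OrbitalMeasureFamily ((cmDatum L 3 (Matrix.of fun i j : Fin 3 => if i.val + j.val + 1 = 3 then (1 : L) else 0)).Local v))
    (hcan : ∀ v, (m v).IsCanonical (P v) (ν v))
    (hK : Rogawski1990.MatchingAdeleGEventuallyKConj L H')
    (hF : CompactCoreCentralizerLevelAE L 3 (Matrix.of fun i j : Fin 3 => if i.val + j.val + 1 = 3 then (1 : L) else 0))
    {γ₀ : (cmDatum L 3 H').Rational} (hreg : Rogawski1990.IsRegularElt (γ₀.val : GL (Fin 3) L))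
    {γ : (cmDatum L 3 (Matrix.of fun i j : Fin 3 => if i.val + j.val + 1 = 3 then (1 : L) else 0)).Rational}
    (hγ : Rogawski1990.Corresponds (cmConjRingHom L) H' (Matrix.of fun i j : Fin 3 => if i.val + j.val + 1 = 3 then (1 : L) else 0) γ₀ γ)
    (p : Rogawski1990.MatchingAdeleG L H' γ₀)
    (hP : ∀ v, P v (Quotient.out (ConjClasses.mk
      ((cmDatum L 3 (Matrix.of fun i j : Fin 3 => if i.val + j.val + 1 = 3 then (1 : L) else 0)).toLocal v p.adele)))) :
    ∃ S₀ : Finset (HeightOneSpectrum (𝓞 ↥(maximalRealSubfield L))),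
      IsNormalisedOff L 3 (Matrix.of fun i j : Fin 3 => if i.val + j.val + 1 = 3 then (1 : L) else 0) m p.adele S₀ := by
  refine exists_isNormalisedOff_of_eventually L 3 _ P ν m hν hcan p.adele hP ?_
  have hγreg : Rogawski1990.IsRegularElt (γ.val : GL (Fin 3) L) := Rogawski1990.isRegularElt_of_isConj hγ hreg
  filter_upwards [hK.eventually_forall_exists_conj hreg hγ, Rogawski1990.eventually_toLocal_mem_cmLocalIntegralLevel p.adele, hF γ hγreg]
    with v hv hint hcc
  obtain ⟨k, hk, hkp⟩ := hv p hint
  rw [← hkp]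
  exact compactCore_centralizer_conj_subset _ _ k hk hcc

end UnitaryGroup

end Literature.NumberTheory.Automorphic

end
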